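import Summits.QuantumFields.BalabanUV.T4Continuum.Support.SubstrateBackground
import Summits.QuantumFields.BalabanUV.T4Continuum.Support.SubstrateTwoRunsDriven

/-!
# SUBSTRATE — BACKGROUND FIELDS OF RECORD, follow-up: the background over `V = 1` chosen `= 1` (NE7's `oneA ∕ oneB`, typer Q-S6),
# and the NON-TRIVIAL driven two-run object of record by compactness (§O1 O-1's inhabitant, [dict] line D-3)

Cell `pub-balaban`, SUBSTRATE cell, seat `b2b-balaban-substrate-p2`; follower of `Support/SubstrateBackground` (p218175) requested by the
typer-liaison (`substrate/p2/NEXT.md` gen 2 item 1 (a)(b); MAP v0.2 §4 p2 (1), Q-S6).  Summits-side bookkeeping over p1's two-run object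
`SubstrateTwoRunsDriven.DrivenRuns` (p217182) BY NAME; edits nothing.

HONEST FRAMING (T4-DAG p. 1).  Rung (B)+1 of the FINITE-VOLUME T⁴ continuum programme — NOT infinite volume, NOT a mass gap, NOT the
Clay problem, NOT summit progress, no estimate.  The backgrounds are MINIMISERS BY THE EXTREME-VALUE THEOREM (existence half of the TYPE
of [Balaban1985Variational] Thm 1; no regularity, no uniqueness, nothing printed asserted).  HONEST DEPENDENCY (cell line, verbatim):
continuum YM on T⁴ ⇐ BetaPertH ∧ nine spine estimates (0/9 proved); BetaPertH ⇐ (D1) ∧ (D4) ∧ CAP+tail; G-an2-4 gates asym, D1 and NE2/3/4.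

WHAT THIS FILE DOES.
* §1 **THE TRIVIAL CONFIGURATION IS ITS OWN BACKGROUND** (typer Q-S6): `wilsonAction4_one` (`A(1) = 0`), `isBackground_one`: if `1 ∈ reg`
  then `IsBackground av reg k (M^k 1) 1` (the Wilson action is `≥ 0` and vanishes at `1`); `iter_one` (`M^k 1 = 1` for averagings
  fixing `1` — DISPLAYED hypothesis `hav1 : ∀ j, (av j).avg 1 = 1`; an abstract `Setup.Averaging` ∕ `LoopAverage` does not force it).
* §2 **`backgroundOfRecordOne av reg h h1 : Setup.Background P G av`** — the background of record of `SubstrateBackground` MODIFIED to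
  choose `1` over every `V = M^k 1` (else a chosen minimiser); `backgroundOfRecordOne_U_iter_one` (`U k (M^k 1) = 1`), domain =
  `reachable`, `isBackground_backgroundOfRecordOne`; the compactness version `backgroundOfRecordCompactOne`.
* §3 **`drivenOfRecord`** = `DrivenRuns.balaban F K m′ ℰ (backgroundOfRecordCompactOne …A) (… B) gA gB` — the NON-TRIVIAL driven
  two-run object on a compact Hausdorff group with continuous `Re tr`, for Bałaban's block averaging `blockAvg ℰ` under the DISPLAYED
  GLOBAL continuity of `blockAvg ℰ` (v1.1 DOCFIX, R-ne9leaf07g8-1: satisfiable at the trivial ∕ axial `ℰ`, NOT at the guarded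
  `ExpMeanLog.expMeanLogU∕SU` of record — use §5's `drivenOfRecordOn`, continuity ON the class) and closed classes `regA ∋ 1`, `regB ∋ 1`;
  `drivenOfRecord_domV` (its driving domain = fields whose top copies are reachable in both runs) and **`one_mem_domV_drivenOfRecord`**
  (`1 ∈ domV` when `blockAvg ℰ` fixes `1`), with `uA ∕ uB` at `V = 1` EQUAL TO `1` (`uA_one_drivenOfRecord`, `uB_one_drivenOfRecord`) —
  NE7 NODE O.1's `oneA ∕ oneB`.
* §4–§5 (v1.1, APPENDED; R-ne9leaf07g8-1 ∕ F-SUB-T1): `blockAvg_one_of_E_one` (leaf-07-g8's §P4, with credit) and **`drivenOfRecordOn`**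
  (continuity of `M^k` ON the classes only) with `one_mem_domV ∕ uA_one ∕ uB_one_drivenOfRecordOn` under `ℰ.E (1,…,1) = 1`.
No estimate, no `def … : Prop`, no `sorry`.
-/

noncomputable section

open scoped BigOperators Topology

namespace Summit.QuantumFields.BalabanUV.T4Continuum.SubstrateBackgroundDriven

open Literature.MathematicalPhysics.QuantumFieldTheory.Balaban1983to89
open Literature.MathematicalPhysics.QuantumFieldTheory.Balaban1983to89.T4Continuum (T4Family)
open Literature.MathematicalPhysics.QuantumFieldTheory.Balaban1983to89.T4LevelShift (fieldShift)
open Summit.QuantumFields.BalabanUV.T4Continuum.SubstrateBackground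
open Summit.QuantumFields.BalabanUV.T4Continuum.SubstrateTwoRunsDriven

variable {P : Params} {G : Type*} [GaugeGroup G]

/-! ## §1 The trivial configuration is its own background -/

/-- [folklore] The plaquette variables of the trivial configuration are trivial. -/
theorem plaqHol_one {j : ℕ} (p : Plaq P j) : GaugeField.plaqHol (1 : GaugeField P j G) p = 1 := by
  simp [GaugeField.plaqHol, show ∀ b : PBond P j, (1 : GaugeField P j G) b = 1 from fun _ => rfl]

/-- [folklore] **`A(1) = 0`**: the Wilson action vanishes at the trivial configuration (`Re tr 1 = 1`). -/
theorem wilsonAction4_one {j : ℕ} : wilsonAction4 (1 : GaugeField P j G) = 0 := by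
  simp [wilsonAction4, wilsonAction, plaqHol_one, GaugeGroup.reTr_one]

/-- [folklore] Averagings fixing the trivial configuration fix it after any number of steps (DISPLAYED hypothesis `hav1`). -/
theorem iter_one (av : ∀ j, Averaging P j G) (hav1 : ∀ j, (av j).avg 1 = 1) : ∀ k, Averaging.iter av k (1 : GaugeField P 0 G) = 1
  | 0 => rfl
  | k + 1 => by
    show (av k).avg (Averaging.iter av k 1) = 1
    rw [iter_one av hav1 k, hav1 k]

/-- [folklore] **THE TRIVIAL CONFIGURATION IS A BACKGROUND over its own `k`-fold average**, for every class containing it: the Wilson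
action is nonnegative (`wilsonAction4_nonneg`) and vanishes at `1`. -/
theorem isBackground_one (av : ∀ j, Averaging P j G) {reg : Set (GaugeField P 0 G)} (h1 : (1 : GaugeField P 0 G) ∈ reg) (k : ℕ) :
    IsBackground av reg k (Averaging.iter av k 1) 1 :=
  ⟨rfl, h1, fun U _ _ => by rw [wilsonAction4_one]; exact wilsonAction4_nonneg U⟩

/-! ## §2 The background of record choosing `1` over `V = M^k 1` -/

open Classical in
/-- [folklore] **THE BACKGROUND OF RECORD, NORMALISED AT THE TRIVIAL FIELD** (typer Q-S6): as `SubstrateBackground.backgroundOfRecord`, but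
over every level-`k` field of the form `M^k 1` the chosen minimiser IS `1` (legitimate by `isBackground_one` when `1 ∈ reg`). -/
def backgroundOfRecordOne (av : ∀ j, Averaging P j G) (reg : Set (GaugeField P 0 G))
    (h : ∀ (k : ℕ) (V : GaugeField P k G), V ∈ reachable av reg k → ∃ U₀, IsBackground av reg k V U₀)
    (h1 : (1 : GaugeField P 0 G) ∈ reg) : Background P G av where
  reg := reg
  dom := reachable av reg
  U := fun k V => if V = Averaging.iter av k 1 then 1 else if hV : V ∈ reachable av reg k then (h k V hV).choose else 1
  isBackground := fun k V hV => by
    by_cases hV1 : V = Averaging.iter av k 1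
    · simp only [hV1, if_true]
      exact isBackground_one av h1 k
    · simp only [hV1, if_false, dif_pos hV]
      exact (h k V hV).choose_spec

/-- [folklore] Its class is `reg` (`rfl`). -/
@[simp] theorem backgroundOfRecordOne_reg (av : ∀ j, Averaging P j G) (reg : Set (GaugeField P 0 G))
    (h : ∀ (k : ℕ) (V : GaugeField P k G), V ∈ reachable av reg k → ∃ U₀, IsBackground av reg k V U₀)
    (h1 : (1 : GaugeField P 0 G) ∈ reg) : (backgroundOfRecordOne av reg h h1).reg = reg := rfl

/-- [folklore] Its domain is the reachable set (`rfl`). -/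
@[simp] theorem backgroundOfRecordOne_dom (av : ∀ j, Averaging P j G) (reg : Set (GaugeField P 0 G))
    (h : ∀ (k : ℕ) (V : GaugeField P k G), V ∈ reachable av reg k → ∃ U₀, IsBackground av reg k V U₀)
    (h1 : (1 : GaugeField P 0 G) ∈ reg) (k : ℕ) : (backgroundOfRecordOne av reg h h1).dom k = reachable av reg k := rfl

/-- [folklore] **THE BACKGROUND OVER `M^k 1` IS `1`** (NE7 NODE O.1's `oneA ∕ oneB`). -/
theorem backgroundOfRecordOne_U_iter_one (av : ∀ j, Averaging P j G) (reg : Set (GaugeField P 0 G))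
    (h : ∀ (k : ℕ) (V : GaugeField P k G), V ∈ reachable av reg k → ∃ U₀, IsBackground av reg k V U₀)
    (h1 : (1 : GaugeField P 0 G) ∈ reg) (k : ℕ) :
    (backgroundOfRecordOne av reg h h1).U k (Averaging.iter av k 1) = 1 := by
  classical
  show (if Averaging.iter av k (1 : GaugeField P 0 G) = Averaging.iter av k 1 then (1 : GaugeField P 0 G) else _) = 1
  rw [if_pos rfl]

/-- [folklore] In particular, for averagings fixing `1`, the background over the trivial level-`k` field is `1`. -/
theorem backgroundOfRecordOne_U_one (av : ∀ j, Averaging P j G) (hav1 : ∀ j, (av j).avg 1 = 1) (reg : Set (GaugeField P 0 G))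
    (h : ∀ (k : ℕ) (V : GaugeField P k G), V ∈ reachable av reg k → ∃ U₀, IsBackground av reg k V U₀)
    (h1 : (1 : GaugeField P 0 G) ∈ reg) (k : ℕ) :
    (backgroundOfRecordOne av reg h h1).U k 1 = 1 := by
  have e := backgroundOfRecordOne_U_iter_one av reg h h1 k
  rwa [iter_one av hav1 k] at e

/-- [folklore] On the domain it IS a background (`Background.isBackground` by name). -/
theorem isBackground_backgroundOfRecordOne (av : ∀ j, Averaging P j G) (reg : Set (GaugeField P 0 G))
    (h : ∀ (k : ℕ) (V : GaugeField P k G), V ∈ reachable av reg k → ∃ U₀, IsBackground av reg k V U₀)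
    (h1 : (1 : GaugeField P 0 G) ∈ reg) {k : ℕ} {V : GaugeField P k G} (hV : V ∈ reachable av reg k) :
    IsBackground av reg k V ((backgroundOfRecordOne av reg h h1).U k V) :=
  (backgroundOfRecordOne av reg h h1).isBackground k V hV

/-- [folklore] The trivial level-`k` average is reachable from any class containing `1`. -/
theorem iter_one_mem_reachable (av : ∀ j, Averaging P j G) {reg : Set (GaugeField P 0 G)} (h1 : (1 : GaugeField P 0 G) ∈ reg)
    (k : ℕ) : Averaging.iter av k 1 ∈ reachable av reg k :=
  iter_mem_reachable av h1 k

/-- [folklore] **THE NORMALISED BACKGROUND OF RECORD FROM COMPACTNESS** (`SubstrateBackground.forall_exists_isBackground` supplies the witness). -/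
def backgroundOfRecordCompactOne [TopologicalSpace G] [IsTopologicalGroup G] [CompactSpace G] [T2Space G]
    (hreTr : Continuous (reTr : G → ℝ)) (av : ∀ j, Averaging P j G) (hav : ∀ j, Continuous (av j).avg)
    (reg : Set (GaugeField P 0 G)) (hreg : IsClosed reg) (h1 : (1 : GaugeField P 0 G) ∈ reg) : Background P G av :=
  backgroundOfRecordOne av reg (forall_exists_isBackground hreTr av hav hreg) h1

/-- [folklore] Its domain is the reachable set (`rfl`). -/
@[simp] theorem backgroundOfRecordCompactOne_dom [TopologicalSpace G] [IsTopologicalGroup G] [CompactSpace G] [T2Space G]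
    (hreTr : Continuous (reTr : G → ℝ)) (av : ∀ j, Averaging P j G) (hav : ∀ j, Continuous (av j).avg)
    (reg : Set (GaugeField P 0 G)) (hreg : IsClosed reg) (h1 : (1 : GaugeField P 0 G) ∈ reg) (k : ℕ) :
    (backgroundOfRecordCompactOne hreTr av hav reg hreg h1).dom k = reachable av reg k := rfl

/-- [folklore] Its background over `M^k 1` is `1`. -/
theorem backgroundOfRecordCompactOne_U_iter_one [TopologicalSpace G] [IsTopologicalGroup G] [CompactSpace G] [T2Space G]
    (hreTr : Continuous (reTr : G → ℝ)) (av : ∀ j, Averaging P j G) (hav : ∀ j, Continuous (av j).avg)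
    (reg : Set (GaugeField P 0 G)) (hreg : IsClosed reg) (h1 : (1 : GaugeField P 0 G) ∈ reg) (k : ℕ) :
    (backgroundOfRecordCompactOne hreTr av hav reg hreg h1).U k (Averaging.iter av k 1) = 1 :=
  backgroundOfRecordOne_U_iter_one av reg _ h1 k

/-! ## §3 The non-trivial driven two-run object of record -/

section Driven

variable {G : Type} [GaugeGroup G] [TopologicalSpace G] [IsTopologicalGroup G] [CompactSpace G] [T2Space G]

/-- [folklore] **THE DRIVEN TWO-RUN OBJECT OF RECORD BY COMPACTNESS** (§O1 O-1's inhabitant): `DrivenRuns.balaban` (p1) with BOTH runs'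
background assignments the normalised backgrounds of record of §2 — minimisers by the extreme-value theorem on the closed classes
`regA ∋ 1`, `regB ∋ 1`, for Bałaban's block averaging `blockAvg ℰ` under its DISPLAYED continuity (an abstract `LoopAverage` carries no
continuity axiom; v1.1 DOCFIX, R-ne9leaf07g8-1: it holds at the trivial ∕ axial `ℰ` and FAILS at the guarded `expMeanLogU∕SU` of record —
the object at the `ℰ` of record is §5's `drivenOfRecordOn`), couplings `gA`, `gB`. -/
def drivenOfRecord (hreTr : Continuous (reTr : G → ℝ)) (F : T4Family) (K m' : ℕ) (ℰ : LoopAverage G)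
    (hcont : ∀ (P' : Params) (j : ℕ), Continuous (BlockAveraging.blockAvg (P := P') (j := j) ℰ).avg)
    (regA : Set (GaugeField (F.P K) 0 G)) (hregA : IsClosed regA) (h1A : (1 : GaugeField (F.P K) 0 G) ∈ regA)
    (regB : Set (GaugeField (F.P (K + 1)) 0 G)) (hregB : IsClosed regB) (h1B : (1 : GaugeField (F.P (K + 1)) 0 G) ∈ regB)
    (gA gB : ℕ → ℝ) : DrivenRuns G :=
  DrivenRuns.balaban F K m' ℰ
    (backgroundOfRecordCompactOne hreTr (fun j => BlockAveraging.blockAvg (j := j) ℰ) (fun j => hcont _ j) regA hregA h1A)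
    (backgroundOfRecordCompactOne hreTr (fun j => BlockAveraging.blockAvg (j := j) ℰ) (fun j => hcont _ j) regB hregB h1B) gA gB

variable (hreTr : Continuous (reTr : G → ℝ)) (F : T4Family) (K m' : ℕ) (ℰ : LoopAverage G)
  (hcont : ∀ (P' : Params) (j : ℕ), Continuous (BlockAveraging.blockAvg (P := P') (j := j) ℰ).avg)
  (regA : Set (GaugeField (F.P K) 0 G)) (hregA : IsClosed regA) (h1A : (1 : GaugeField (F.P K) 0 G) ∈ regA)
  (regB : Set (GaugeField (F.P (K + 1)) 0 G)) (hregB : IsClosed regB) (h1B : (1 : GaugeField (F.P (K + 1)) 0 G) ∈ regB)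
  (gA gB : ℕ → ℝ)

/-- [folklore] Its carriers are the unrestricted carriers of record with Bałaban's averaging as the transport (p1's `balaban_toTwoRuns`). -/
theorem drivenOfRecord_toTwoRuns :
    (drivenOfRecord hreTr F K m' ℰ hcont regA hregA h1A regB hregB h1B gA gB).toTwoRuns =
      B13Carriers.TwoRuns.univ F K m' (BlockAveraging.blockAvg ℰ) :=
  DrivenRuns.balaban_toTwoRuns F K m' ℰ _ _ gA gB

/-- [folklore] **ITS DRIVING DOMAIN**: the unit fields whose top copies are REACHABLE in both runs (averages of class members). -/
theorem mem_domV_drivenOfRecord_iff (V : UnitField F G) :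
    V ∈ (drivenOfRecord hreTr F K m' ℰ hcont regA hregA h1A regB hregB h1B gA gB).domV ↔
      atTop K V ∈ reachable (fun j => BlockAveraging.blockAvg (j := j) ℰ) regA K ∧
        atTop (K + 1) V ∈ reachable (fun j => BlockAveraging.blockAvg (j := j) ℰ) regB (K + 1) :=
  Iff.rfl

omit [TopologicalSpace G] [IsTopologicalGroup G] [CompactSpace G] [T2Space G] in
/-- [folklore] The top copy of the trivial unit field is the trivial field. -/
theorem atTop_one (K : ℕ) : atTop (F := F) K (1 : UnitField F G) = 1 := rfl

/-- [folklore] **`1 ∈ domV`** for the driven object of record, as soon as Bałaban's averaging fixes the trivial field (DISPLAYED: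
`hav1`; then `M^k 1 = 1` in both runs and `1` is reachable from classes containing it) — so NE7 NODE O.1's `oneA ∕ oneB` are read at a
driving field. -/
theorem one_mem_domV_drivenOfRecord (hav1 : ∀ (P' : Params) (j : ℕ), (BlockAveraging.blockAvg (P := P') (j := j) ℰ).avg 1 = 1) :
    (1 : UnitField F G) ∈ (drivenOfRecord hreTr F K m' ℰ hcont regA hregA h1A regB hregB h1B gA gB).domV := by
  rw [mem_domV_drivenOfRecord_iff, atTop_one, atTop_one]
  constructor
  · have e := iter_one (fun j => BlockAveraging.blockAvg (P := F.P K) (j := j) ℰ) (fun j => hav1 _ j) K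
    rw [← e]
    exact iter_one_mem_reachable _ h1A K
  · have e := iter_one (fun j => BlockAveraging.blockAvg (P := F.P (K + 1)) (j := j) ℰ) (fun j => hav1 _ j) (K + 1)
    rw [← e]
    exact iter_one_mem_reachable _ h1B (K + 1)

/-- [folklore] **`oneA`**: run A's background of the trivial driving field is the trivial configuration. -/
theorem uA_one_drivenOfRecord (hav1 : ∀ (P' : Params) (j : ℕ), (BlockAveraging.blockAvg (P := P') (j := j) ℰ).avg 1 = 1) :
    ((drivenOfRecord hreTr F K m' ℰ hcont regA hregA h1A regB hregB h1B gA gB).uA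
        ⟨1, one_mem_domV_drivenOfRecord hreTr F K m' ℰ hcont regA hregA h1A regB hregB h1B gA gB hav1⟩).1 = 1 := by
  show (backgroundOfRecordCompactOne hreTr (fun j => BlockAveraging.blockAvg (j := j) ℰ) (fun j => hcont _ j) regA hregA h1A).U K
      (atTop K (1 : UnitField F G)) = 1
  rw [atTop_one]
  exact backgroundOfRecordOne_U_one _ (fun j => hav1 _ j) regA _ h1A K

/-- [folklore] **`oneB`**: run B's background of the trivial driving field is the trivial configuration. -/
theorem uB_one_drivenOfRecord (hav1 : ∀ (P' : Params) (j : ℕ), (BlockAveraging.blockAvg (P := P') (j := j) ℰ).avg 1 = 1) :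
    ((drivenOfRecord hreTr F K m' ℰ hcont regA hregA h1A regB hregB h1B gA gB).uB
        ⟨1, one_mem_domV_drivenOfRecord hreTr F K m' ℰ hcont regA hregA h1A regB hregB h1B gA gB hav1⟩).1 = 1 := by
  show (backgroundOfRecordCompactOne hreTr (fun j => BlockAveraging.blockAvg (j := j) ℰ) (fun j => hcont _ j) regB hregB h1B).U (K + 1)
      (atTop (K + 1) (1 : UnitField F G)) = 1
  rw [atTop_one]
  exact backgroundOfRecordOne_U_one _ (fun j => hav1 _ j) regB _ h1B (K + 1)

end Driven

/-! ## §4 (v1.1, appended) `M 1 = 1` for every small-loop average normalised at identity families — lifted WITH CREDIT from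
ne9-formalise-leaf-07-g8's probe `ProbeSubstrateBackgroundDriven.lean` §P4 (journal l.13634), so that `hav1` is discharged generically
(the `ExpMeanLog.expMeanLogU∕SU` instances: `SubstrateBlockAvgContinuity`) -/

section HavOne

open Literature.MathematicalPhysics.QuantumFieldTheory.Balaban1983to89.T4Continuum (holAt holAt_nil holAt_cons)
open Literature.MathematicalPhysics.QuantumFieldTheory.Balaban1983to89.AveragingRT (axialAvg pathProd)
open Literature.MathematicalPhysics.QuantumFieldTheory.Balaban1983to89.BlockAveraging (blockAvg blockAvg_avg avgFun corr Small loopHol)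

variable {j : ℕ}

/-- [folklore] The holonomy of the trivial configuration along any walk is `1` (leaf-07-g8 §P4). -/
theorem holAt_one_cfg (γ : List (T4Continuum.LStep P j)) : holAt (1 : GaugeField P j G) γ = 1 := by
  induction γ with
  | nil => exact holAt_nil _
  | cons s γ ih =>
    rw [holAt_cons, ih, show (1 : GaugeField P j G) s.bond = 1 from rfl]
    split_ifs <;> simp

/-- [folklore] Every (0.4) loop variable of the trivial configuration is `1` (leaf-07-g8 §P4). -/
theorem loopHol_one_cfg (c : PBond P (j + 1)) (i : BlockAveraging.Idx P) : loopHol (1 : GaugeField P j G) c i = 1 :=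
  holAt_one_cfg _

/-- [folklore] The straight-line transporters of the trivial configuration are `1` (leaf-07-g8 §P4). -/
theorem pathProd_one_cfg (c : PBond P (j + 1)) : ∀ n, pathProd (1 : GaugeField P j G) c n = 1
  | 0 => rfl
  | n + 1 => by
    show pathProd (1 : GaugeField P j G) c n * (1 : GaugeField P j G) (AveragingRT.line c n) = 1
    rw [pathProd_one_cfg c n, show (1 : GaugeField P j G) (AveragingRT.line c n) = 1 from rfl, one_mul]

/-- [folklore] The axial average of the trivial configuration is trivial (leaf-07-g8 §P4). -/
theorem axialAvg_one_cfg : axialAvg (1 : GaugeField P j G) = 1 :=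
  funext fun c => pathProd_one_cfg c P.L

/-- [folklore] The trivial configuration is in every small-field guard (leaf-07-g8 §P4). -/
theorem small_one_cfg (ℰ : LoopAverage G) (c : PBond P (j + 1)) : Small ℰ (1 : GaugeField P j G) c := fun i => by
  rw [loopHol_one_cfg, GaugeGroup.dist1_one]; exact ℰ.δ_pos

/-- [folklore] **`hav1` AT ANY LEVEL for any small-loop average NORMALISED AT IDENTITY FAMILIES** (`ℰ.E (1,…,1) = 1`):
`(blockAvg ℰ).avg 1 = 1` (leaf-07-g8 §P4, `blockAvg_one_of_E_one`; the trivial average: `rfl`; the averages of record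
`expMeanLogU∕SU`: `SubstrateBlockAvgContinuity`). -/
theorem blockAvg_one_of_E_one (ℰ : LoopAverage G) (hE : ∀ m : ℕ, ℰ.E (fun _ : Fin (m + 1) => (1 : G)) = 1) :
    (blockAvg (P := P) (j := j) ℰ).avg 1 = 1 := by
  rw [blockAvg_avg]
  funext c
  show corr ℰ 1 c * axialAvg 1 c = 1
  rw [axialAvg_one_cfg, corr, if_pos (small_one_cfg ℰ c)]
  have hl : loopHol (1 : GaugeField P j G) c = fun _ => 1 := funext (loopHol_one_cfg c)
  rw [hl]
  show ℰ.E ((fun _ => (1 : G)) ∘ _) * (1 : GaugeField P (j + 1) G) c = 1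
  rw [show ((fun _ : BlockAveraging.Idx P => (1 : G)) ∘ ⇑(LoopAverage.enum (BlockAveraging.Idx P)).symm) =
      fun _ => 1 from rfl, hE, show (1 : GaugeField P (j + 1) G) c = 1 from rfl, one_mul]

/-- [folklore] The trivial small-loop average is normalised at identity families (`rfl`). -/
theorem trivial_E_one (m : ℕ) : (LoopAverage.trivial G).E (fun _ : Fin (m + 1) => (1 : G)) = 1 := rfl

end HavOne

/-! ## §5 (v1.1, appended) The driven object of record with continuity ON THE CLASSES only — repair of R-ne9leaf07g8-1 ∕ F-SUB-T1
(MAP v0.4 §O1 D-3″; typer NEXT gen 4 task 1): hypotheses `hiterA ∕ hiterB : ∀ k, ContinuousOn (M^k) reg` on the two tori `F.P K`,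
`F.P (K+1)` ONLY, satisfiable at `expMeanLogU∕SU` on Bałaban's nested small-field classes (`SubstrateBlockAvgContinuity`) -/

section DrivenOn

variable {G : Type} [GaugeGroup G] [TopologicalSpace G] [IsTopologicalGroup G] [CompactSpace G] [T2Space G]

/-- [folklore] **THE NORMALISED BACKGROUND OF RECORD, CONTINUITY ON THE CLASS** (`SubstrateBackground.forall_exists_isBackground_of_continuousOn`
supplies the witness; `1` chosen over `V = M^k 1`). -/
def backgroundOfRecordCompactOneOn (hreTr : Continuous (reTr : G → ℝ)) (av : ∀ j, Averaging P j G)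
    (reg : Set (GaugeField P 0 G)) (hreg : IsClosed reg) (hiter : ∀ k, ContinuousOn (Averaging.iter av k) reg)
    (h1 : (1 : GaugeField P 0 G) ∈ reg) : Background P G av :=
  backgroundOfRecordOne av reg (forall_exists_isBackground_of_continuousOn hreTr av hreg hiter) h1

/-- [folklore] Its domain is the reachable set (`rfl`). -/
@[simp] theorem backgroundOfRecordCompactOneOn_dom (hreTr : Continuous (reTr : G → ℝ)) (av : ∀ j, Averaging P j G)
    (reg : Set (GaugeField P 0 G)) (hreg : IsClosed reg) (hiter : ∀ k, ContinuousOn (Averaging.iter av k) reg)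
    (h1 : (1 : GaugeField P 0 G) ∈ reg) (k : ℕ) :
    (backgroundOfRecordCompactOneOn hreTr av reg hreg hiter h1).dom k = reachable av reg k := rfl

/-- [folklore] **THE DRIVEN TWO-RUN OBJECT OF RECORD, CONTINUITY ON THE CLASSES ONLY**: `DrivenRuns.balaban` with both runs'
backgrounds the normalised compactness backgrounds under `hiterA ∕ hiterB : ∀ k, ContinuousOn (M^k) reg` on `F.P K`, `F.P (K+1)`. -/
def drivenOfRecordOn (hreTr : Continuous (reTr : G → ℝ)) (F : T4Family) (K m' : ℕ) (ℰ : LoopAverage G)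
    (regA : Set (GaugeField (F.P K) 0 G)) (hregA : IsClosed regA) (h1A : (1 : GaugeField (F.P K) 0 G) ∈ regA)
    (hiterA : ∀ k, ContinuousOn (Averaging.iter (fun j => BlockAveraging.blockAvg (P := F.P K) (j := j) ℰ) k) regA)
    (regB : Set (GaugeField (F.P (K + 1)) 0 G)) (hregB : IsClosed regB) (h1B : (1 : GaugeField (F.P (K + 1)) 0 G) ∈ regB)
    (hiterB : ∀ k, ContinuousOn (Averaging.iter (fun j => BlockAveraging.blockAvg (P := F.P (K + 1)) (j := j) ℰ) k) regB)
    (gA gB : ℕ → ℝ) : DrivenRuns G :=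
  DrivenRuns.balaban F K m' ℰ
    (backgroundOfRecordCompactOneOn hreTr (fun j => BlockAveraging.blockAvg (j := j) ℰ) regA hregA hiterA h1A)
    (backgroundOfRecordCompactOneOn hreTr (fun j => BlockAveraging.blockAvg (j := j) ℰ) regB hregB hiterB h1B) gA gB

variable (hreTr : Continuous (reTr : G → ℝ)) (F : T4Family) (K m' : ℕ) (ℰ : LoopAverage G)
  (regA : Set (GaugeField (F.P K) 0 G)) (hregA : IsClosed regA) (h1A : (1 : GaugeField (F.P K) 0 G) ∈ regA)
  (hiterA : ∀ k, ContinuousOn (Averaging.iter (fun j => BlockAveraging.blockAvg (P := F.P K) (j := j) ℰ) k) regA)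
  (regB : Set (GaugeField (F.P (K + 1)) 0 G)) (hregB : IsClosed regB) (h1B : (1 : GaugeField (F.P (K + 1)) 0 G) ∈ regB)
  (hiterB : ∀ k, ContinuousOn (Averaging.iter (fun j => BlockAveraging.blockAvg (P := F.P (K + 1)) (j := j) ℰ) k) regB)
  (gA gB : ℕ → ℝ)

/-- [folklore] Its carriers are the unrestricted carriers of record with Bałaban's averaging as the transport. -/
theorem drivenOfRecordOn_toTwoRuns :
    (drivenOfRecordOn hreTr F K m' ℰ regA hregA h1A hiterA regB hregB h1B hiterB gA gB).toTwoRuns =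
      B13Carriers.TwoRuns.univ F K m' (BlockAveraging.blockAvg ℰ) :=
  DrivenRuns.balaban_toTwoRuns F K m' ℰ _ _ gA gB

/-- [folklore] **ITS DRIVING DOMAIN**: the unit fields whose top copies are reachable in both runs. -/
theorem mem_domV_drivenOfRecordOn_iff (V : UnitField F G) :
    V ∈ (drivenOfRecordOn hreTr F K m' ℰ regA hregA h1A hiterA regB hregB h1B hiterB gA gB).domV ↔
      atTop K V ∈ reachable (fun j => BlockAveraging.blockAvg (j := j) ℰ) regA K ∧
        atTop (K + 1) V ∈ reachable (fun j => BlockAveraging.blockAvg (j := j) ℰ) regB (K + 1) :=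
  Iff.rfl

/-- [folklore] **`1 ∈ domV`** for a small-loop average normalised at identity families (`hE`; `expMeanLogU∕SU`: `SubstrateBlockAvgContinuity`). -/
theorem one_mem_domV_drivenOfRecordOn (hE : ∀ m : ℕ, ℰ.E (fun _ : Fin (m + 1) => (1 : G)) = 1) :
    (1 : UnitField F G) ∈ (drivenOfRecordOn hreTr F K m' ℰ regA hregA h1A hiterA regB hregB h1B hiterB gA gB).domV := by
  rw [mem_domV_drivenOfRecordOn_iff, atTop_one, atTop_one]
  constructor
  · have e := iter_one (fun j => BlockAveraging.blockAvg (P := F.P K) (j := j) ℰ) (fun _ => blockAvg_one_of_E_one ℰ hE) K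
    rw [← e]
    exact iter_one_mem_reachable _ h1A K
  · have e := iter_one (fun j => BlockAveraging.blockAvg (P := F.P (K + 1)) (j := j) ℰ) (fun _ => blockAvg_one_of_E_one ℰ hE) (K + 1)
    rw [← e]
    exact iter_one_mem_reachable _ h1B (K + 1)

/-- [folklore] **`oneA`** at the object with continuity on the classes. -/
theorem uA_one_drivenOfRecordOn (hE : ∀ m : ℕ, ℰ.E (fun _ : Fin (m + 1) => (1 : G)) = 1) :
    ((drivenOfRecordOn hreTr F K m' ℰ regA hregA h1A hiterA regB hregB h1B hiterB gA gB).uA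
        ⟨1, one_mem_domV_drivenOfRecordOn hreTr F K m' ℰ regA hregA h1A hiterA regB hregB h1B hiterB gA gB hE⟩).1 = 1 := by
  show (backgroundOfRecordCompactOneOn hreTr (fun j => BlockAveraging.blockAvg (j := j) ℰ) regA hregA hiterA h1A).U K
      (atTop K (1 : UnitField F G)) = 1
  rw [atTop_one]
  exact backgroundOfRecordOne_U_one _ (fun _ => blockAvg_one_of_E_one ℰ hE) regA _ h1A K

/-- [folklore] **`oneB`** at the object with continuity on the classes. -/
theorem uB_one_drivenOfRecordOn (hE : ∀ m : ℕ, ℰ.E (fun _ : Fin (m + 1) => (1 : G)) = 1) :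
    ((drivenOfRecordOn hreTr F K m' ℰ regA hregA h1A hiterA regB hregB h1B hiterB gA gB).uB
        ⟨1, one_mem_domV_drivenOfRecordOn hreTr F K m' ℰ regA hregA h1A hiterA regB hregB h1B hiterB gA gB hE⟩).1 = 1 := by
  show (backgroundOfRecordCompactOneOn hreTr (fun j => BlockAveraging.blockAvg (j := j) ℰ) regB hregB hiterB h1B).U (K + 1)
      (atTop (K + 1) (1 : UnitField F G)) = 1
  rw [atTop_one]
  exact backgroundOfRecordOne_U_one _ (fun _ => blockAvg_one_of_E_one ℰ hE) regB _ h1B (K + 1)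

end DrivenOn

end Summit.QuantumFields.BalabanUV.T4Continuum.SubstrateBackgroundDriven

end
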